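import Literature.Analysis.FunctionSpaces.TorusTrilinearH1
import Literature.Analysis.FunctionSpaces.TorusLinearisedNSEnergy
import Literature.Analysis.FunctionSpaces.TorusH1DistanceBounds
import Literature.Analysis.FunctionSpaces.TorusH2BoundedH1Cauchy
import Literature.Analysis.FunctionSpaces.TorusMollifiedFieldFourierBounds
import HarnessLib

/-!
# Bounds that pass to `H¹` / `L²` limits of smooth fields on the flat torus

Analysis/FunctionSpaces support file (everything proved; no definitions, no named facts) collecting the
elementary facts by which uniform bounds along a sequence of smooth real vector fields on `T^d` survive
in the limit — the bookkeeping of "the limit solution keeps the a-priori bounds" in compactness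
arguments for strong Navier–Stokes solutions (Robinson–Rodrigo–Sadowski 2016, proof of Thm 6.10 /
§8.1; Foias–Temam 1989, passage to the limit in the Gevrey estimate):

* `Torus.sqrt_gradNormSq_le_sqrt_add_sqrt` — Minkowski for the gradient seminorm,
  `‖∇v‖₂ ≤ ‖∇w‖₂ + ‖∇(v − w)‖₂` (general `d`; the `T³` special case is the summit-side
  `stub_trainBudget_aux_sqrt_gradNormSq_le`), via the packed gradients in `PiLp 2` and
  `Torus.sqrt_integral_norm_add_sq_le`;
* `Torus.gradNormSq_le_of_tendsto_gradNormSq_sub` — `‖∇vₙ‖₂² ≤ R` and `‖∇(vₙ − w)‖₂² → 0` give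
  `‖∇w‖₂² ≤ R`;
* `Torus.integral_norm_le_sqrt_integral_norm_sq_of_continuous` — `∫ ‖g‖ ≤ (∫ ‖g‖²)^{1/2}` on the
  probability space `T^d`; `Torus.tendsto_mFourierCoeff_of_tendsto_integral_norm_sub_sq` — `L²`
  convergence gives convergence of every Fourier coefficient; `Torus.sum_mul_norm_sq_mFourierCoeff_le_of_tendsto`
  — hence weighted FINITE sums `∑_{k ∈ S} a_k ‖v̂ₙ(k)‖² ≤ C` (e.g. Gevrey or Sobolev partial sums) pass to
  `L²` limits;
* `Torus.gradNormSq_le_sqrt_integral_mul_sqrt_integral_laplacian` — the interpolation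
  `‖∇v‖₂² ≤ ‖v‖₂ ‖Δv‖₂` (Green's identity `‖∇v‖₂² = −∫⟪Δv, v⟫` and Cauchy–Schwarz), by which `L²`-close
  fields in an `H²`-bounded set are `H¹`-close.

Tree search (`lean search 'sqrt_gradNormSq|gradNormSq_le_sqrt|norm_mFourierCoeff_le'`): Minkowski for
`‖∇·‖₂` only at `d = Fin 3` in summit files; the two higher interpolation inequalities
(`TorusSobolevInterpolationCS`) but not the basic one; coefficient bounds `‖v̂(k)‖ ≤ ∫ ‖v‖`
(`Torus.norm_mFourierCoeff_complexify_le_integral_norm`, reused).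

## References

* J. C. Robinson, J. L. Rodrigo, W. Sadowski, *The Three-Dimensional Navier–Stokes Equations*, CUP 2016,
  Thm 6.10 and §8.1. [RobinsonRodrigoSadowskiCUP2016]
* C. Foias, R. Temam, *Gevrey class regularity for the solutions of the Navier–Stokes equations*,
  J. Funct. Anal. 87 (1989) 359–369. [FoiasTemam1989]
-/

open _root_.MeasureTheory Set Filter Function UnitAddTorus
open scoped ENNReal NNReal InnerProductSpace Topology ContDiff

noncomputable section

namespace Literature.Analysis.FunctionSpaces

namespace Torus

variable {d : Type*} [Fintype d] [DecidableEq d]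

/-! ## Minkowski for the gradient seminorm -/

section Minkowski

variable {v w : UnitAddTorus d → EuclideanSpace ℝ d}

/-- `‖∇f‖₂² = ∫ ‖(∂ᵢ f)ᵢ‖²` with the gradient packed into `PiLp 2` (`PiLp.norm_sq_eq_of_L2`). [folklore] -/
theorem gradNormSq_eq_integral_norm_toLp_sq (f : UnitAddTorus d → EuclideanSpace ℝ d) :
    gradNormSq f =
      ∫ x, ‖(WithLp.toLp 2 (fun i => partialDeriv i f x) : PiLp 2 (fun _ : d => EuclideanSpace ℝ d))‖ ^ 2 := by
  unfold gradNormSq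
  congr 1
  funext x
  rw [PiLp.norm_sq_eq_of_L2]

/-- The packed gradient of a smooth field is continuous. [folklore] -/
theorem continuous_toLp_partialDeriv {f : UnitAddTorus d → EuclideanSpace ℝ d} (hf : IsSmooth f) :
    Continuous fun x => (WithLp.toLp 2 (fun i => partialDeriv i f x) : PiLp 2 (fun _ : d => EuclideanSpace ℝ d)) :=
  (PiLp.continuous_toLp 2 _).comp (continuous_pi fun i => (hf.partialDeriv i).continuous)

/-- **Minkowski for the gradient seminorm** (general `d`): `‖∇v‖₂ ≤ ‖∇w‖₂ + ‖∇(v − w)‖₂` for smooth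
fields on `T^d` (`Torus.sqrt_integral_norm_add_sq_le` for the packed gradients,
`∂ᵢv = ∂ᵢw + ∂ᵢ(v − w)`). [folklore] -/
theorem sqrt_gradNormSq_le_sqrt_add_sqrt (hv : IsSmooth v) (hw : IsSmooth w) :
    Real.sqrt (gradNormSq v) ≤
      Real.sqrt (gradNormSq w) + Real.sqrt (gradNormSq (fun x => v x - w x)) := by
  have hvw : IsSmooth (fun x => v x - w x) := hv.sub hw
  have hpd : ∀ i x, partialDeriv i v x = partialDeriv i w x + partialDeriv i (fun y => v y - w y) x := by
    intro i x
    have h := congrFun (partialDeriv_sub (hv.isContDiff (by simp)) (hw.isContDiff (by simp)) i) x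
    rw [Pi.sub_apply] at h
    rw [show (fun y => v y - w y) = v - w from rfl, h]
    abel
  have hsum : ∀ x, (WithLp.toLp 2 (fun i => partialDeriv i v x) : PiLp 2 (fun _ : d => EuclideanSpace ℝ d)) =
      WithLp.toLp 2 (fun i => partialDeriv i w x) +
        WithLp.toLp 2 (fun i => partialDeriv i (fun y => v y - w y) x) := by
    intro x
    rw [← WithLp.toLp_add]
    congr 1
    funext i
    rw [Pi.add_apply, hpd i x]
  have h := sqrt_integral_norm_add_sq_le (continuous_toLp_partialDeriv hw) (continuous_toLp_partialDeriv hvw)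
  have hfun : (fun x => ‖(WithLp.toLp 2 (fun i => partialDeriv i v x) : PiLp 2 (fun _ : d => EuclideanSpace ℝ d))‖ ^ 2) =
      fun x => ‖(WithLp.toLp 2 (fun i => partialDeriv i w x) : PiLp 2 (fun _ : d => EuclideanSpace ℝ d)) +
        WithLp.toLp 2 (fun i => partialDeriv i (fun y => v y - w y) x)‖ ^ 2 :=
    funext fun x => by rw [hsum x]
  rw [gradNormSq_eq_integral_norm_toLp_sq v, gradNormSq_eq_integral_norm_toLp_sq w,
    gradNormSq_eq_integral_norm_toLp_sq (fun x => v x - w x), hfun]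
  exact h

/-- **An enstrophy bound passes to `H¹` limits**: if `‖∇vₙ‖₂² ≤ R` for all `n` and
`‖∇(vₙ − w)‖₂² → 0`, then `‖∇w‖₂² ≤ R` (Minkowski `‖∇w‖₂ ≤ ‖∇vₙ‖₂ + ‖∇(w − vₙ)‖₂ ≤ √R + o(1)`).
[folklore] -/
theorem gradNormSq_le_of_tendsto_gradNormSq_sub {v : ℕ → UnitAddTorus d → EuclideanSpace ℝ d}
    {w : UnitAddTorus d → EuclideanSpace ℝ d} (hv : ∀ n, IsSmooth (v n)) (hw : IsSmooth w) {R : ℝ}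
    (hb : ∀ n, gradNormSq (v n) ≤ R)
    (hlim : Tendsto (fun n => gradNormSq (fun x => v n x - w x)) atTop (𝓝 0)) :
    gradNormSq w ≤ R := by
  have hR : 0 ≤ R := (gradNormSq_nonneg _).trans (hb 0)
  -- `√‖∇w‖² ≤ √R + √‖∇(vₙ - w)‖²` for every `n`
  have hn : ∀ n, Real.sqrt (gradNormSq w) ≤ Real.sqrt R + Real.sqrt (gradNormSq (fun x => v n x - w x)) := by
    intro n
    have h := sqrt_gradNormSq_le_sqrt_add_sqrt hw (hv n)
    rw [gradNormSq_sub_comm w (v n)] at h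
    exact h.trans (add_le_add_left (Real.sqrt_le_sqrt (hb n)) _)
  have hlim' : Tendsto (fun n => Real.sqrt R + Real.sqrt (gradNormSq (fun x => v n x - w x))) atTop
      (𝓝 (Real.sqrt R + Real.sqrt 0)) :=
    tendsto_const_nhds.add ((Real.continuous_sqrt.tendsto 0).comp hlim)
  rw [Real.sqrt_zero, add_zero] at hlim'
  have hle : Real.sqrt (gradNormSq w) ≤ Real.sqrt R := ge_of_tendsto' hlim' hn
  calc gradNormSq w = Real.sqrt (gradNormSq w) ^ 2 := (Real.sq_sqrt (gradNormSq_nonneg _)).symm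
    _ ≤ Real.sqrt R ^ 2 := pow_le_pow_left₀ (Real.sqrt_nonneg _) hle 2
    _ = R := Real.sq_sqrt hR

end Minkowski

/-! ## Fourier coefficients of `L²`-convergent sequences -/

section Coefficients

omit [DecidableEq d] in
/-- `∫ ‖g‖ ≤ (∫ ‖g‖²)^{1/2}` for a continuous field on the probability space `T^d` (Cauchy–Schwarz
against `1`). [folklore] -/
theorem integral_norm_le_sqrt_integral_norm_sq_of_continuous {E : Type*} [NormedAddCommGroup E]
    {g : UnitAddTorus d → E} (hg : Continuous g) :
    ∫ x, ‖g x‖ ≤ Real.sqrt (∫ x, ‖g x‖ ^ 2) := by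
  have h := integral_mul_le_sqrt_mul_sqrt_of_continuous hg.norm continuous_const (fun x => norm_nonneg (g x))
    (fun _ => zero_le_one)
  simpa using h

omit [DecidableEq d] in
/-- **`L²` convergence gives convergence of every Fourier coefficient**: for continuous `vₙ, w` with
`∫ ‖vₙ − w‖² → 0`, `v̂ₙ(k) → ŵ(k)` for every `k` (`‖v̂ₙ(k) − ŵ(k)‖ = ‖(vₙ − w)^(k)‖ ≤ ∫ ‖vₙ − w‖ ≤ ‖vₙ − w‖₂`).
[folklore] -/
theorem tendsto_mFourierCoeff_of_tendsto_integral_norm_sub_sq {v : ℕ → UnitAddTorus d → EuclideanSpace ℝ d}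
    {w : UnitAddTorus d → EuclideanSpace ℝ d} (hv : ∀ n, Continuous (v n)) (hw : Continuous w)
    (hlim : Tendsto (fun n => ∫ x, ‖v n x - w x‖ ^ 2) atTop (𝓝 0)) (k : d → ℤ) :
    Tendsto (fun n => mFourierCoeff (EuclideanSpace.complexify ∘ v n) k) atTop
      (𝓝 (mFourierCoeff (EuclideanSpace.complexify ∘ w) k)) := by
  rw [tendsto_iff_norm_sub_tendsto_zero]
  have hbound : ∀ n, ‖mFourierCoeff (EuclideanSpace.complexify ∘ v n) k -
      mFourierCoeff (EuclideanSpace.complexify ∘ w) k‖ ≤ Real.sqrt (∫ x, ‖v n x - w x‖ ^ 2) := by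
    intro n
    have hi : Integrable (v n) volume := (hv n).integrable_unitAddTorus
    have hiw : Integrable w volume := hw.integrable_unitAddTorus
    have h1 := congrFun (mFourierCoeff_complexify_sub hi hiw) k
    rw [Pi.sub_apply] at h1
    rw [h1]
    refine (norm_mFourierCoeff_complexify_le_integral_norm (hi.sub hiw) k).trans ?_
    exact integral_norm_le_sqrt_integral_norm_sq_of_continuous ((hv n).sub hw)
  have hsqrt : Tendsto (fun n => Real.sqrt (∫ x, ‖v n x - w x‖ ^ 2)) atTop (𝓝 0) := by
    have h := (Real.continuous_sqrt.tendsto 0).comp hlim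
    rwa [Real.sqrt_zero] at h
  exact squeeze_zero (fun n => norm_nonneg _) hbound hsqrt

omit [DecidableEq d] in
/-- **Weighted finite sums of squared coefficients pass to `L²` limits**: if
`∑_{k ∈ S} a_k ‖v̂ₙ(k)‖² ≤ C` for all `n` and `∫ ‖vₙ − w‖² → 0` (continuous fields), then
`∑_{k ∈ S} a_k ‖ŵ(k)‖² ≤ C` — in particular uniform Gevrey bounds `∑_{k∈S} e^{2σ|k|}‖v̂ₙ(k)‖² ≤ C`
and Sobolev partial sums survive in the limit. [folklore] -/
theorem sum_mul_norm_sq_mFourierCoeff_le_of_tendsto {v : ℕ → UnitAddTorus d → EuclideanSpace ℝ d}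
    {w : UnitAddTorus d → EuclideanSpace ℝ d} (hv : ∀ n, Continuous (v n)) (hw : Continuous w)
    (hlim : Tendsto (fun n => ∫ x, ‖v n x - w x‖ ^ 2) atTop (𝓝 0)) (a : (d → ℤ) → ℝ)
    (S : Finset (d → ℤ)) {C : ℝ}
    (hb : ∀ n, ∑ k ∈ S, a k * ‖mFourierCoeff (EuclideanSpace.complexify ∘ v n) k‖ ^ 2 ≤ C) :
    ∑ k ∈ S, a k * ‖mFourierCoeff (EuclideanSpace.complexify ∘ w) k‖ ^ 2 ≤ C := by
  have hsum : Tendsto (fun n => ∑ k ∈ S, a k * ‖mFourierCoeff (EuclideanSpace.complexify ∘ v n) k‖ ^ 2)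
      atTop (𝓝 (∑ k ∈ S, a k * ‖mFourierCoeff (EuclideanSpace.complexify ∘ w) k‖ ^ 2)) :=
    tendsto_finsetSum S fun k _ =>
      (((tendsto_mFourierCoeff_of_tendsto_integral_norm_sub_sq hv hw hlim k).norm).pow 2).const_mul _
  exact le_of_tendsto' hsum hb

end Coefficients

/-! ## The basic interpolation inequality -/

section Interpolation

/-- **`‖∇v‖₂² ≤ ‖v‖₂ ‖Δv‖₂`** for a smooth real vector field on `T^d`: Green's identity
`‖∇v‖₂² = −∫⟪Δv, v⟫` (`Torus.integral_inner_laplacian_self_eq_neg_gradNormSq_of_isSmooth`) and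
Cauchy–Schwarz. On an `H²`-bounded set of fields, `L²`-closeness therefore controls `H¹`-closeness.
[folklore] -/
theorem gradNormSq_le_sqrt_integral_mul_sqrt_integral_laplacian {v : UnitAddTorus d → EuclideanSpace ℝ d}
    (hv : IsSmooth v) :
    gradNormSq v ≤ Real.sqrt (∫ x, ‖v x‖ ^ 2) * Real.sqrt (∫ x, ‖laplacian v x‖ ^ 2) := by
  have hΔ : IsSmooth (laplacian v) := hv.laplacian
  have hG : gradNormSq v = -∫ x, ⟪laplacian v x, v x⟫_ℝ := by
    rw [integral_inner_laplacian_self_eq_neg_gradNormSq_of_isSmooth hv, neg_neg]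
  have h1 : -∫ x, ⟪laplacian v x, v x⟫_ℝ ≤ ∫ x, ‖v x‖ * ‖laplacian v x‖ := by
    rw [← integral_neg]
    refine integral_mono ((hΔ.continuous.inner hv.continuous).neg.integrable_unitAddTorus)
      ((hv.continuous.norm.mul hΔ.continuous.norm).integrable_unitAddTorus) fun x => ?_
    show -⟪laplacian v x, v x⟫_ℝ ≤ ‖v x‖ * ‖laplacian v x‖
    rw [real_inner_comm]
    exact (neg_le_abs _).trans (abs_real_inner_le_norm _ _)
  have h2 := integral_mul_le_sqrt_mul_sqrt_of_continuous hv.continuous.norm hΔ.continuous.norm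
    (fun x => norm_nonneg _) (fun x => norm_nonneg _)
  rw [hG]
  exact h1.trans h2

end Interpolation

end Torus

end Literature.Analysis.FunctionSpaces

end
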